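import Literature.NumberTheory.Automorphic.UnitaryGroupPureTensorContinuity
import HarnessLib

/-!
# Pure tensors on a PRODUCT `U(H₂)(𝔸_{L⁺}) × U(H₁)(𝔸_{L⁺})` (the endoscopic side `H = U(2) × U(1)` of the `U(3)` trace formula):
# factorizable test data, evaluation, unramified levels, the unit tensor, continuity and compact support (`toCc`)
(Rogawski (1990), §4.9 p. 54, §14.2 p. 233; Borel–Jacquet, Corvallis (1979), §4.1)

Topic `NumberTheory/Rogawski1990`; namespace `Literature.NumberTheory.Automorphic.UnitaryGroup` (as ★ `TestFunctions`).  DEFINITIONS WITH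
BODIES (`PureTensor₂`, `PureTensor₂.eval`, `IsUnramified₂`, `unit`, `toCc`) and proved lemmas; no named fact, no `sorry`, no instance, no notation.

**Why a second structure.** The endoscopic group of `G = U(3)` is `H = U(2) × U(1)` ([Rogawski1990] §4.9); its adelic points in the tree are the
PRODUCT `(cmDatum L N₂ H₂).Adelic × (cmDatum L N₁ H₁).Adelic` of two unitary data (the ENGINE T1 line's `HAdelic L`, `N₂ = 2`, `N₁ = 1`, split
forms), and a factorizable `f^H = f^H_∞ ⊗ ⊗_v f^H_v` has local factors on the product local groups `U(H₂)(L⁺_v) × U(H₁)(L⁺_v)` which need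
NOT be products of factors — so ★ `PureTensor` (one datum) does not apply, but everything else is the same: a finite bad set `S`, unramified
levels `K₂ v × K₁ v`, local factors equal to `1_{K₂ v × K₁ v}` off `S`, an archimedean factor on `U(H₂)(L⁺ ⊗ ℝ) × U(H₁)(L⁺ ⊗ ℝ)`.

* §1 `PureTensor₂` and `eval` (`eval (g₂,g₁) = 1_{∀ v ∉ S, (g₂,g₁)_v ∈ K₂ v × K₁ v} · f_∞ · ∏_{v ∈ S} f_v`), `eval_eq_of_forall_mem`,
  `eval_eq_zero_of_not_mem`, `eval_eq_indicator`; `IsUnramified₂` (the levels ARE the integral levels ★ `cmLocalIntegralLevel` off `S` — the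
  hyperspecial `K_{H,v} = K_{2,v} × K_{1,v}` of [Rogawski1990] §4.9 (b): at unramified `v` the transfer of the unit of `𝓗(G_v)` is the UNIT of
  `𝓗(H_v)`); the unit tensor `PureTensor₂.unit H₂ H₁ a` (`S = ∅`) and `unit_eval_one`.
* §2 continuity and compact support for unramified tensors with continuous ∕ compactly supported factors (the unramified set is the clopen
  `K^S(H₂) × K^S(H₁)`, ★ `isClopen_awayIntegralLevel`; supports sit in products of the compact boxes ★ `isCompact_setOf_archPart_mem_forall_evalPlace_mem`):
  `continuous_eval`, `hasCompactSupport_eval`, **`toCc : C_c(U(H₂)(𝔸) × U(H₁)(𝔸), ℂ)`** (`toCc_apply` `rfl`).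

Written for the cell `hodgecm-mathlib` (ENGINE T1, line `F0_T1InnerFormTraceIdentity`, brick (b′): the carrier of the H-side away-transfer
`GlobalTransferAwayH`, file `UnitaryGroupTransferAwayH`).  HC_CM is proved only modulo the printed citations until rung 0 closes; this file is
unconditional and asserts nothing about transfer.

## References
* [Rogawski1990] J. Rogawski, Ann. of Math. Stud. 123 (1990), §4.9 Prop. 4.9.1 p. 54 (`f ↦ f^H`; (b) `f^H = ξ̂_H(f)` for spherical `f` at unramified
  `v`), §14.2 p. 233.
* [BorelJacquet1979] A. Borel, H. Jacquet, PSPM 33.1 (1979), §4.1 (factorizable functions on `G(𝔸)`).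
-/

set_option autoImplicit false

noncomputable section

open NumberField IsDedekindDomain Filter Set
open scoped Classical

namespace Literature.NumberTheory.Automorphic.UnitaryGroup

variable (L : Type) [Field L] [NumberField L] [IsCMField L] {N₂ N₁ : ℕ}
  (H₂ : Matrix (Fin N₂) (Fin N₂) L) (H₁ : Matrix (Fin N₁) (Fin N₁) L)

/-! ## §1 Pure tensors on `U(H₂)(𝔸) × U(H₁)(𝔸)` -/

/-- **`PureTensor₂ L H₂ H₁` — FACTORIZABLE test data on the product `U(H₂)(𝔸_{L⁺}) × U(H₁)(𝔸_{L⁺})`** (the endoscopic side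
`H = U(2) × U(1)` of [Rogawski1990] §4.9 for `N₂ = 2`, `N₁ = 1`): a finite BAD SET `S`, unramified levels `K₂ v ≤ U(H₂)(L⁺_v)`, `K₁ v ≤ U(H₁)(L⁺_v)`,
LOCAL FACTORS `loc v` on the product local group (NOT assumed to be products), equal to `1_{K₂ v × K₁ v}` off `S`, and an ARCHIMEDEAN FACTOR on
`U(H₂)(L⁺ ⊗ ℝ) × U(H₁)(L⁺ ⊗ ℝ)`. [cite: Rogawski1990, §4.9 p. 54] [cite: BorelJacquet1979, §4.1] -/
structure PureTensor₂ : Type where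
  /-- the finite bad set of finite places of `L⁺` -/
  S : Finset (HeightOneSpectrum (𝓞 ↥(maximalRealSubfield L)))
  /-- the unramified levels in the first factor -/
  K₂ : ∀ v : HeightOneSpectrum (𝓞 ↥(maximalRealSubfield L)), Subgroup ((cmDatum L N₂ H₂).Local v)
  /-- the unramified levels in the second factor -/
  K₁ : ∀ v : HeightOneSpectrum (𝓞 ↥(maximalRealSubfield L)), Subgroup ((cmDatum L N₁ H₁).Local v)
  /-- the local factors on `U(H₂)(L⁺_v) × U(H₁)(L⁺_v)` -/
  loc : ∀ v : HeightOneSpectrum (𝓞 ↥(maximalRealSubfield L)), (cmDatum L N₂ H₂).Local v × (cmDatum L N₁ H₁).Local v → ℂ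
  /-- the archimedean factor on `U(H₂)(L⁺ ⊗ ℝ) × U(H₁)(L⁺ ⊗ ℝ)` -/
  arch : UnitaryGroup.arch (↥(maximalRealSubfield L)) L (IsCMField.complexConj L) N₂ H₂ ×
    UnitaryGroup.arch (↥(maximalRealSubfield L)) L (IsCMField.complexConj L) N₁ H₁ → ℂ
  /-- off the bad set the local factor is the indicator of the product of the unramified levels -/
  loc_eq_indicator : ∀ v ∉ S, loc v =
    ((K₂ v : Set ((cmDatum L N₂ H₂).Local v)) ×ˢ (K₁ v : Set ((cmDatum L N₁ H₁).Local v))).indicator fun _ => 1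

namespace PureTensor₂

variable {L H₂ H₁}

/-- The local components of a pair `(g₂, g₁)` at `v`. [cite: BorelJacquet1979, §4.1] -/
abbrev locPair (v : HeightOneSpectrum (𝓞 ↥(maximalRealSubfield L))) (p : (cmDatum L N₂ H₂).Adelic × (cmDatum L N₁ H₁).Adelic) :
    (cmDatum L N₂ H₂).Local v × (cmDatum L N₁ H₁).Local v :=
  ((cmDatum L N₂ H₂).toLocal v p.1, (cmDatum L N₁ H₁).toLocal v p.2)

/-- The archimedean components of a pair. [cite: BorelJacquet1979, §4.1] -/
abbrev archPair (p : (cmDatum L N₂ H₂).Adelic × (cmDatum L N₁ H₁).Adelic) :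
    UnitaryGroup.arch (↥(maximalRealSubfield L)) L (IsCMField.complexConj L) N₂ H₂ ×
      UnitaryGroup.arch (↥(maximalRealSubfield L)) L (IsCMField.complexConj L) N₁ H₁ :=
  (archPart (↥(maximalRealSubfield L)) L (IsCMField.complexConj L) N₂ H₂ p.1,
    archPart (↥(maximalRealSubfield L)) L (IsCMField.complexConj L) N₁ H₁ p.2)

/-- The UNRAMIFIED SET of a tensor: pairs whose local components lie in the levels off `S`. [cite: BorelJacquet1979, §4.1] -/
def unramifiedSet (T : PureTensor₂ L H₂ H₁) : Set ((cmDatum L N₂ H₂).Adelic × (cmDatum L N₁ H₁).Adelic) :=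
  {p | ∀ v ∉ T.S, (cmDatum L N₂ H₂).toLocal v p.1 ∈ T.K₂ v ∧ (cmDatum L N₁ H₁).toLocal v p.2 ∈ T.K₁ v}

/-- Membership in the unramified set. [cite: BorelJacquet1979, §4.1] -/
theorem mem_unramifiedSet_iff (T : PureTensor₂ L H₂ H₁) (p : (cmDatum L N₂ H₂).Adelic × (cmDatum L N₁ H₁).Adelic) :
    p ∈ T.unramifiedSet ↔ ∀ v ∉ T.S, (cmDatum L N₂ H₂).toLocal v p.1 ∈ T.K₂ v ∧ (cmDatum L N₁ H₁).toLocal v p.2 ∈ T.K₁ v :=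
  Iff.rfl

/-- **Evaluation of a pure tensor on the product**: `eval T (g₂, g₁) = 1_{unramified} · f_∞(g_∞) · ∏_{v ∈ S} f_v((g₂)_v, (g₁)_v)` — the
restricted product of the local factors. [cite: Rogawski1990, §4.9 p. 54] [cite: BorelJacquet1979, §4.1] -/
def eval (T : PureTensor₂ L H₂ H₁) (p : (cmDatum L N₂ H₂).Adelic × (cmDatum L N₁ H₁).Adelic) : ℂ :=
  T.unramifiedSet.indicator (fun p => T.arch (archPair p) * ∏ v ∈ T.S, T.loc v (locPair v p)) p

/-- On the unramified set, `eval` is the archimedean factor times the finite product over `S`. [cite: Rogawski1990, §4.9 p. 54] -/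
theorem eval_eq_of_mem (T : PureTensor₂ L H₂ H₁) {p : (cmDatum L N₂ H₂).Adelic × (cmDatum L N₁ H₁).Adelic} (hp : p ∈ T.unramifiedSet) :
    T.eval p = T.arch (archPair p) * ∏ v ∈ T.S, T.loc v (locPair v p) := by
  rw [eval, Set.indicator_of_mem hp]

/-- Off the unramified set `eval` vanishes. [cite: Rogawski1990, §4.9 p. 54] -/
theorem eval_eq_zero_of_not_mem (T : PureTensor₂ L H₂ H₁) {p : (cmDatum L N₂ H₂).Adelic × (cmDatum L N₁ H₁).Adelic}
    (hp : p ∉ T.unramifiedSet) : T.eval p = 0 := by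
  rw [eval, Set.indicator_of_notMem hp]

/-- `eval` vanishes where the archimedean factor does. [cite: BorelJacquet1979, §4.1] -/
theorem eval_eq_zero_of_arch_eq_zero (T : PureTensor₂ L H₂ H₁) {p : (cmDatum L N₂ H₂).Adelic × (cmDatum L N₁ H₁).Adelic}
    (hp : T.arch (archPair p) = 0) : T.eval p = 0 := by
  by_cases h : p ∈ T.unramifiedSet
  · rw [eval_eq_of_mem T h, hp, zero_mul]
  · exact eval_eq_zero_of_not_mem T h

/-- `eval` vanishes where a local factor at a bad place does. [cite: BorelJacquet1979, §4.1] -/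
theorem eval_eq_zero_of_loc_eq_zero (T : PureTensor₂ L H₂ H₁) {p : (cmDatum L N₂ H₂).Adelic × (cmDatum L N₁ H₁).Adelic}
    {v : HeightOneSpectrum (𝓞 ↥(maximalRealSubfield L))} (hv : v ∈ T.S) (hp : T.loc v (locPair v p) = 0) : T.eval p = 0 := by
  by_cases h : p ∈ T.unramifiedSet
  · rw [eval_eq_of_mem T h, Finset.prod_eq_zero hv hp, mul_zero]
  · exact eval_eq_zero_of_not_mem T h

/-- **`T.IsUnramified₂`** — off `S` the levels ARE the integral levels `U(H₂)(𝒪_v)`, `U(H₁)(𝒪_v)` (★ `cmLocalIntegralLevel`), so that the local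
factor there is the indicator of the hyperspecial `K_{H,v} = U(H₂)(𝒪_v) × U(H₁)(𝒪_v)` — the UNIT of `𝓗(H_v)`, which is the transfer of the unit of
`𝓗(G_v)` at unramified `v` ([Rogawski1990] Prop. 4.9.1 (b): `f^H = ξ̂_H(f)` on the spherical Hecke algebra). [cite: Rogawski1990, §4.9 p. 54] -/
def IsUnramified₂ (T : PureTensor₂ L H₂ H₁) : Prop :=
  ∀ v ∉ T.S, T.K₂ v = cmLocalIntegralLevel L N₂ H₂ v ∧ T.K₁ v = cmLocalIntegralLevel L N₁ H₁ v

variable (L H₂ H₁) in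
/-- **The unit tensor** `f_∞ ⊗ ⊗_v 1_{U(H₂)(𝒪_v) × U(H₁)(𝒪_v)}` with prescribed archimedean factor: `S = ∅`, integral levels and indicator factors
everywhere. [cite: Rogawski1990, §4.9 p. 54] -/
def unit (a : UnitaryGroup.arch (↥(maximalRealSubfield L)) L (IsCMField.complexConj L) N₂ H₂ ×
    UnitaryGroup.arch (↥(maximalRealSubfield L)) L (IsCMField.complexConj L) N₁ H₁ → ℂ) : PureTensor₂ L H₂ H₁ where
  S := ∅
  K₂ := fun v => cmLocalIntegralLevel L N₂ H₂ v
  K₁ := fun v => cmLocalIntegralLevel L N₁ H₁ v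
  loc := fun v => (((cmLocalIntegralLevel L N₂ H₂ v : Set ((cmDatum L N₂ H₂).Local v)) ×ˢ
    (cmLocalIntegralLevel L N₁ H₁ v : Set ((cmDatum L N₁ H₁).Local v)))).indicator fun _ => 1
  arch := a
  loc_eq_indicator := fun _ _ => rfl

/-- The unit tensor is unramified. [cite: Rogawski1990, §4.9 p. 54] -/
theorem unit_isUnramified₂ (a : UnitaryGroup.arch (↥(maximalRealSubfield L)) L (IsCMField.complexConj L) N₂ H₂ ×
    UnitaryGroup.arch (↥(maximalRealSubfield L)) L (IsCMField.complexConj L) N₁ H₁ → ℂ) : (unit L H₂ H₁ a).IsUnramified₂ :=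
  fun _ _ => ⟨rfl, rfl⟩

/-- The bad set of the unit tensor is empty. [cite: Rogawski1990, §4.9 p. 54] -/
@[simp] theorem unit_S (a : UnitaryGroup.arch (↥(maximalRealSubfield L)) L (IsCMField.complexConj L) N₂ H₂ ×
    UnitaryGroup.arch (↥(maximalRealSubfield L)) L (IsCMField.complexConj L) N₁ H₁ → ℂ) : (unit L H₂ H₁ a).S = ∅ := rfl

/-- The unit tensor at the identity: `eval 1 = f_∞(1)`. [cite: Rogawski1990, §4.9 p. 54] -/
theorem unit_eval_one (a : UnitaryGroup.arch (↥(maximalRealSubfield L)) L (IsCMField.complexConj L) N₂ H₂ ×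
    UnitaryGroup.arch (↥(maximalRealSubfield L)) L (IsCMField.complexConj L) N₁ H₁ → ℂ) : (unit L H₂ H₁ a).eval 1 = a 1 := by
  have h1 : (1 : (cmDatum L N₂ H₂).Adelic × (cmDatum L N₁ H₁).Adelic) ∈ (unit L H₂ H₁ a).unramifiedSet := fun v _ =>
    ⟨by rw [Prod.fst_one, map_one]; exact Subgroup.one_mem _, by rw [Prod.snd_one, map_one]; exact Subgroup.one_mem _⟩
  rw [eval_eq_of_mem _ h1, unit_S, Finset.prod_empty, mul_one]
  exact congrArg a (Prod.ext (map_one _) (map_one _))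

/-! ## §2 Continuity and compact support; `toCc` -/

/-- The unramified set of an unramified tensor is the product of the two away-levels `K^S(H₂) × K^S(H₁)` (★ `awayIntegralLevel`).
[cite: BorelJacquet1979, §4.1] -/
theorem unramifiedSet_eq_prod (T : PureTensor₂ L H₂ H₁) (hT : T.IsUnramified₂) :
    T.unramifiedSet =
      ((awayIntegralLevel (↥(maximalRealSubfield L)) L (IsCMField.complexConj L) N₂ H₂ T.S :
          Subgroup (adelicGroupData (↥(maximalRealSubfield L)) L (IsCMField.complexConj L) N₂ H₂).Adelic) :
        Set (adelicGroupData (↥(maximalRealSubfield L)) L (IsCMField.complexConj L) N₂ H₂).Adelic) ×ˢ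
      ((awayIntegralLevel (↥(maximalRealSubfield L)) L (IsCMField.complexConj L) N₁ H₁ T.S :
          Subgroup (adelicGroupData (↥(maximalRealSubfield L)) L (IsCMField.complexConj L) N₁ H₁).Adelic) :
        Set (adelicGroupData (↥(maximalRealSubfield L)) L (IsCMField.complexConj L) N₁ H₁).Adelic) := by
  ext p
  change (∀ v ∉ T.S, (cmDatum L N₂ H₂).toLocal v p.1 ∈ T.K₂ v ∧ (cmDatum L N₁ H₁).toLocal v p.2 ∈ T.K₁ v) ↔
    p.1 ∈ awayIntegralLevel (↥(maximalRealSubfield L)) L (IsCMField.complexConj L) N₂ H₂ T.S ∧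
      p.2 ∈ awayIntegralLevel (↥(maximalRealSubfield L)) L (IsCMField.complexConj L) N₁ H₁ T.S
  refine Iff.trans ?_ (and_congr
    (mem_awayIntegralLevel_iff (↥(maximalRealSubfield L)) L (IsCMField.complexConj L) N₂ H₂ T.S p.1)
    (mem_awayIntegralLevel_iff (↥(maximalRealSubfield L)) L (IsCMField.complexConj L) N₁ H₁ T.S p.2)).symm
  constructor
  · intro h
    exact ⟨fun v hv => by have h' := (h v hv).1; rw [(hT v hv).1] at h'; exact h',
      fun v hv => by have h' := (h v hv).2; rw [(hT v hv).2] at h'; exact h'⟩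
  · rintro ⟨h₂, h₁⟩ v hv
    exact ⟨(hT v hv).1 ▸ h₂ v hv, (hT v hv).2 ▸ h₁ v hv⟩

/-- The unramified set of an unramified tensor is clopen. [cite: BorelJacquet1979, §4.1] -/
theorem isClopen_unramifiedSet (T : PureTensor₂ L H₂ H₁) (hT : T.IsUnramified₂) : IsClopen T.unramifiedSet := by
  rw [unramifiedSet_eq_prod T hT]
  exact (isClopen_awayIntegralLevel (↥(maximalRealSubfield L)) L (IsCMField.complexConj L) N₂ H₂ T.S).prod
    (isClopen_awayIntegralLevel (↥(maximalRealSubfield L)) L (IsCMField.complexConj L) N₁ H₁ T.S)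

/-- **An unramified tensor with continuous archimedean factor and continuous bad factors is CONTINUOUS** on `U(H₂)(𝔸) × U(H₁)(𝔸)`.
[cite: BorelJacquet1979, §4.1] -/
theorem continuous_eval (T : PureTensor₂ L H₂ H₁) (hT : T.IsUnramified₂) (harch : Continuous T.arch)
    (hloc : ∀ v ∈ T.S, Continuous (T.loc v)) : Continuous T.eval := by
  have hcl := isClopen_unramifiedSet T hT
  refine Continuous.indicator (fun a ha => ?_) ?_
  · rw [hcl.frontier_eq] at ha
    exact absurd ha (Set.notMem_empty a)
  · refine (harch.comp ?_).mul (continuous_finsetProd T.S fun v hv => (hloc v hv).comp ?_)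
    · exact ((continuous_archPart (↥(maximalRealSubfield L)) L (IsCMField.complexConj L) N₂ H₂).comp continuous_fst).prodMk
        ((continuous_archPart (↥(maximalRealSubfield L)) L (IsCMField.complexConj L) N₁ H₁).comp continuous_snd)
    · exact (((cmDatum L N₂ H₂).continuous_toLocal v).comp continuous_fst).prodMk
        (((cmDatum L N₁ H₁).continuous_toLocal v).comp continuous_snd)

/-- **… and it has COMPACT SUPPORT** when the archimedean factor and the bad factors do: the support lies in the product of the two compact
boxes cut out by the projections of the supports (★ `isCompact_setOf_archPart_mem_forall_evalPlace_mem`). [cite: BorelJacquet1979, §4.1] -/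
theorem hasCompactSupport_eval (T : PureTensor₂ L H₂ H₁) (hT : T.IsUnramified₂) (harch : HasCompactSupport T.arch)
    (hloc : ∀ v ∈ T.S, HasCompactSupport (T.loc v)) : HasCompactSupport T.eval := by
  -- the two boxes
  let C₂ : ∀ v : HeightOneSpectrum (𝓞 ↥(maximalRealSubfield L)),
      Set (localPi L (IsCMField.complexConj L) N₂ H₂ v) := fun v =>
    if v ∈ T.S then (localPiEquiv L (IsCMField.complexConj L) N₂ H₂ v).symm '' (Prod.fst '' tsupport (T.loc v))
    else (localInt L (IsCMField.complexConj L) N₂ H₂ v : Set (localPi L (IsCMField.complexConj L) N₂ H₂ v))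
  let C₁ : ∀ v : HeightOneSpectrum (𝓞 ↥(maximalRealSubfield L)),
      Set (localPi L (IsCMField.complexConj L) N₁ H₁ v) := fun v =>
    if v ∈ T.S then (localPiEquiv L (IsCMField.complexConj L) N₁ H₁ v).symm '' (Prod.snd '' tsupport (T.loc v))
    else (localInt L (IsCMField.complexConj L) N₁ H₁ v : Set (localPi L (IsCMField.complexConj L) N₁ H₁ v))
  have hC₂ : ∀ v, IsCompact (C₂ v) := fun v => by
    by_cases hv : v ∈ T.S
    · simp only [C₂, if_pos hv]
      exact ((hloc v hv).isCompact.image continuous_fst).image (localPiEquiv L (IsCMField.complexConj L) N₂ H₂ v).symm.continuous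
    · simp only [C₂, if_neg hv]
      exact isCompact_localInt L (IsCMField.complexConj L) N₂ H₂ v
  have hC₁ : ∀ v, IsCompact (C₁ v) := fun v => by
    by_cases hv : v ∈ T.S
    · simp only [C₁, if_pos hv]
      exact ((hloc v hv).isCompact.image continuous_snd).image (localPiEquiv L (IsCMField.complexConj L) N₁ H₁ v).symm.continuous
    · simp only [C₁, if_neg hv]
      exact isCompact_localInt L (IsCMField.complexConj L) N₁ H₁ v
  have hC₂S : ∀ v ∉ T.S, C₂ v ⊆ localInt L (IsCMField.complexConj L) N₂ H₂ v := fun v hv => by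
    simp only [C₂, if_neg hv]; exact subset_rfl
  have hC₁S : ∀ v ∉ T.S, C₁ v ⊆ localInt L (IsCMField.complexConj L) N₁ H₁ v := fun v hv => by
    simp only [C₁, if_neg hv]; exact subset_rfl
  have hbox := (isCompact_setOf_archPart_mem_forall_evalPlace_mem (↥(maximalRealSubfield L)) L (IsCMField.complexConj L) N₂ H₂ T.S
      (harch.isCompact.image continuous_fst) hC₂ hC₂S).prod
    (isCompact_setOf_archPart_mem_forall_evalPlace_mem (↥(maximalRealSubfield L)) L (IsCMField.complexConj L) N₁ H₁ T.S
      (harch.isCompact.image continuous_snd) hC₁ hC₁S)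
  refine HasCompactSupport.intro hbox fun p hp => ?_
  replace hp := not_and_or.1 hp
  -- `eval p = 0` off the box: the three ways a pair can leave a box
  have key : ∀ {M : ℕ} {J : Matrix (Fin M) (Fin M) L} (g : (cmDatum L M J).Adelic) {C₀ : Set (UnitaryGroup.arch (↥(maximalRealSubfield L)) L
        (IsCMField.complexConj L) M J)} {C : ∀ v, Set (localPi L (IsCMField.complexConj L) M J v)},
      g ∉ {g : (adelicGroupData (↥(maximalRealSubfield L)) L (IsCMField.complexConj L) M J).Adelic |
          archPart (↥(maximalRealSubfield L)) L (IsCMField.complexConj L) M J g ∈ C₀ ∧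
            ∀ v, evalPlace (↥(maximalRealSubfield L)) L (IsCMField.complexConj L) M J v
              (finPart (↥(maximalRealSubfield L)) L (IsCMField.complexConj L) M J g) ∈ C v} →
        archPart (↥(maximalRealSubfield L)) L (IsCMField.complexConj L) M J g ∉ C₀ ∨
          ∃ v, (localPiEquiv L (IsCMField.complexConj L) M J v).symm ((cmDatum L M J).toLocal v g) ∉ C v := by
    intro M J g C₀ C hg
    have hg' : ¬ (archPart (↥(maximalRealSubfield L)) L (IsCMField.complexConj L) M J g ∈ C₀ ∧
        ∀ v, evalPlace (↥(maximalRealSubfield L)) L (IsCMField.complexConj L) M J v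
          (finPart (↥(maximalRealSubfield L)) L (IsCMField.complexConj L) M J g) ∈ C v) := hg
    rcases not_and_or.1 hg' with h₀ | h₁
    · exact Or.inl h₀
    · obtain ⟨v, hv⟩ := not_forall.1 h₁
      refine Or.inr ⟨v, fun h => hv ?_⟩
      have e : (localPiEquiv L (IsCMField.complexConj L) M J v).symm ((cmDatum L M J).toLocal v g) =
          evalPlace (↥(maximalRealSubfield L)) L (IsCMField.complexConj L) M J v
            (finPart (↥(maximalRealSubfield L)) L (IsCMField.complexConj L) M J g) :=
        calc (localPiEquiv L (IsCMField.complexConj L) M J v).symm ((cmDatum L M J).toLocal v g)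
            = (localPiEquiv L (IsCMField.complexConj L) M J v).symm
                (localPiEquiv L (IsCMField.complexConj L) M J v
                  (evalPlace (↥(maximalRealSubfield L)) L (IsCMField.complexConj L) M J v
                    (finPart (↥(maximalRealSubfield L)) L (IsCMField.complexConj L) M J g))) := by
              rw [localPiEquiv_evalPlace_finPart]; rfl
          _ = _ := (localPiEquiv L (IsCMField.complexConj L) M J v).symm_apply_apply _
      rw [← e]
      exact h
  rcases hp with hp₂ | hp₁
  · rcases key p.1 hp₂ with h₀ | ⟨v, hv⟩
    · -- archimedean side of the first factor
      refine eval_eq_zero_of_arch_eq_zero T (image_eq_zero_of_notMem_tsupport fun h => h₀ ⟨archPair p, h, rfl⟩)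
    · by_cases hvS : v ∈ T.S
      · refine eval_eq_zero_of_loc_eq_zero T hvS (image_eq_zero_of_notMem_tsupport fun h => hv ?_)
        simp only [C₂, if_pos hvS]
        exact ⟨(cmDatum L N₂ H₂).toLocal v p.1, ⟨locPair v p, h, rfl⟩, rfl⟩
      · refine eval_eq_zero_of_not_mem T fun h => hv ?_
        simp only [C₂, if_neg hvS]
        have h2 : (cmDatum L N₂ H₂).toLocal v p.1 ∈ cmLocalIntegralLevel L N₂ H₂ v := by rw [← (hT v hvS).1]; exact (h v hvS).1
        exact (localPiEquiv_symm_mem_localInt_iff (IsCMField.complexConj L) N₂ H₂ v _).2 h2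
  · rcases key p.2 hp₁ with h₀ | ⟨v, hv⟩
    · refine eval_eq_zero_of_arch_eq_zero T (image_eq_zero_of_notMem_tsupport fun h => h₀ ⟨archPair p, h, rfl⟩)
    · by_cases hvS : v ∈ T.S
      · refine eval_eq_zero_of_loc_eq_zero T hvS (image_eq_zero_of_notMem_tsupport fun h => hv ?_)
        simp only [C₁, if_pos hvS]
        exact ⟨(cmDatum L N₁ H₁).toLocal v p.2, ⟨locPair v p, h, rfl⟩, rfl⟩
      · refine eval_eq_zero_of_not_mem T fun h => hv ?_
        simp only [C₁, if_neg hvS]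
        have h1 : (cmDatum L N₁ H₁).toLocal v p.2 ∈ cmLocalIntegralLevel L N₁ H₁ v := by rw [← (hT v hvS).2]; exact (h v hvS).2
        exact (localPiEquiv_symm_mem_localInt_iff (IsCMField.complexConj L) N₁ H₁ v _).2 h1

/-- **`PureTensor₂.toCc`: an unramified pure tensor on `U(H₂)(𝔸) × U(H₁)(𝔸)` as an element of `C_c`** (continuous compactly supported factors at the
bad places and at infinity) — the currency `TestH = C_c(HAdelic L, ℂ)` of the ENGINE T1 kit's `TransferH`. [cite: Rogawski1990, §4.9 p. 54] -/
def toCc (T : PureTensor₂ L H₂ H₁) (hT : T.IsUnramified₂) (harch : Continuous T.arch) (harch' : HasCompactSupport T.arch)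
    (hloc : ∀ v ∈ T.S, Continuous (T.loc v)) (hloc' : ∀ v ∈ T.S, HasCompactSupport (T.loc v)) :
    CompactlySupportedContinuousMap ((cmDatum L N₂ H₂).Adelic × (cmDatum L N₁ H₁).Adelic) ℂ :=
  ⟨⟨T.eval, T.continuous_eval hT harch hloc⟩, T.hasCompactSupport_eval hT harch' hloc'⟩

/-- `toCc T … p = T.eval p`. [cite: Rogawski1990, §4.9 p. 54] -/
@[simp] theorem toCc_apply (T : PureTensor₂ L H₂ H₁) (hT : T.IsUnramified₂) (harch : Continuous T.arch)
    (harch' : HasCompactSupport T.arch) (hloc : ∀ v ∈ T.S, Continuous (T.loc v)) (hloc' : ∀ v ∈ T.S, HasCompactSupport (T.loc v))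
    (p : (cmDatum L N₂ H₂).Adelic × (cmDatum L N₁ H₁).Adelic) :
    T.toCc hT harch harch' hloc hloc' p = T.eval p := rfl

end PureTensor₂

end Literature.NumberTheory.Automorphic.UnitaryGroup

end
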